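import Summits.AtomisticToContinuum.BoseEinsteinCondensation.Theorems.BECInfDivCoherenceLevyNegativeMomentRieszAbel
import Summits.AtomisticToContinuum.BoseEinsteinCondensation.Theorems.BECInfDivCoherenceLevyNegativeMomentRieszCalculus
import Summits.AtomisticToContinuum.BoseEinsteinCondensation.Theorems.BECInfDivCoherenceLevyNegativeMomentRieszBars

/-!
# Crux `LevyNegativeMoment` (stmt-AtomisticToContinuum-9115), line `registered`, stub `stub_rieszSum` —
# part D: the one-dimensional character sums `T = Σ_{t<m} ζ^t g_ρ(t̄)`

Helper file (lead prover of the line) for the L-free grid Riesz sum bound (stub `stub_rieszSum`).  With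
`ζ = ζ_{m,j}`, `g_ρ(x) = (x²+ρ²)^{-1/2}` and `t̄ = min(t % m, m - t % m)`, the sum `T = Σ_{t<m} ζ^t g_ρ(t̄)` obeys

* (first order, parts A + C) `‖T‖ ≤ ‖ζ⁻¹-1‖⁻¹ · 2/ρ` for `ρ ≥ 1` and `‖T‖ ≤ ‖ζ⁻¹-1‖⁻¹ · 4` for `ρ = 0`
  (`norm_charSum_le_first`, `norm_charSum_le_first_zero`): one cyclic Abel step and the cyclic total
  variation of `g_ρ(t̄)`;
* (orders two and three, parts A + B + C) for `ρ ≥ 1`, `m ≥ 3`: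
  `‖T‖ ≤ ‖ζ⁻¹-1‖⁻³ · 288/ρ³ + ‖ζ⁻¹-1‖⁻² · 4β`, `β = g_ρ(M₀-1) - g_ρ(M₀+1) ≤ 2M₀ g_ρ(M₀-1)³`, `M₀ = m/2`
  (`norm_charSum_le_third`): the second difference of `g_ρ(t̄)` is the smooth stencil `A((t+1)‾)`,
  `A(u) = g(u+1) - 2g(u) + g(u-1)`, except at the (at most two) stencils centred at the top level `M₀`, where the
  defect is at most `2β`; the smooth part takes a third cyclic Abel step and is summed by the third-difference
  bound of part B.
-/

namespace Summit.AtomisticToContinuum.BoseEinsteinCondensation.Cruxes.LevyNegativeMoment.Birth.Riesz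

open scoped BigOperators
open Finset

/-! ## First order -/

/-- One cyclic Abel step in norm: for `F` with `F m = F 0`, `ζ^m = 1`, `‖ζ‖ = 1`, `ζ ≠ 1`,
`‖Σ_{t<m} ζ^t F t‖ ≤ ‖ζ⁻¹ - 1‖⁻¹ Σ_{t<m} |F(t+1) - F t|`. [folklore] -/
theorem cyclic_abel1_bound {ζ : ℂ} (hζ : ‖ζ‖ = 1) (hζ1 : ζ ≠ 1) {m : ℕ} (hm : ζ ^ m = 1)
    {F : ℕ → ℝ} (hF : F m = F 0) :
    ‖∑ t ∈ range m, ζ ^ t * (F t : ℂ)‖ ≤ ‖ζ⁻¹ - 1‖⁻¹ * ∑ t ∈ range m, |F (t + 1) - F t| := by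
  have hζ0 : ζ ≠ 0 := by
    intro h; rw [h, norm_zero] at hζ; exact zero_ne_one hζ
  have hw : ζ⁻¹ - 1 ≠ 0 := by
    intro h
    apply hζ1
    exact inv_eq_one.mp (sub_eq_zero.mp h)
  have hFm : ((F m : ℝ) : ℂ) = F 0 := by exact_mod_cast hF
  have h := cyclic_shift hζ0 hm (F := fun t => (F t : ℂ)) hFm
  set S : ℂ := ∑ t ∈ range m, ζ ^ t * (F t : ℂ) with hS
  have key : (ζ⁻¹ - 1) * S = ∑ t ∈ range m, ζ ^ t * ((F (t + 1) : ℂ) - F t) := by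
    rw [sub_mul, one_mul, ← h, hS, ← sum_sub_distrib]
    refine sum_congr rfl fun t _ => ?_
    ring
  have eS : S = (ζ⁻¹ - 1)⁻¹ * ∑ t ∈ range m, ζ ^ t * ((F (t + 1) : ℂ) - F t) := by
    rw [← key]; field_simp
  rw [eS, norm_mul, norm_inv]
  gcongr
  refine (norm_sum_le _ _).trans (le_of_eq (sum_congr rfl fun t _ => ?_))
  rw [norm_mul, norm_pow, hζ, one_pow, one_mul, ← Complex.ofReal_sub, Complex.norm_real,
    Real.norm_eq_abs]

section charsum

variable {ρ : ℝ} {g : ℝ → ℝ} (hg : ∀ y, g y = (Real.sqrt (y ^ 2 + ρ ^ 2))⁻¹)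
include hg

/-- `g_ρ` at the integer points is nonnegative. [folklore] -/
theorem G_nonneg_nat (n : ℕ) : 0 ≤ g n := G_nonneg hg n

/-- First-order bound, `ρ ≥ 1`: `‖Σ_{t<m} ζ^t g(t̄)‖ ≤ ‖ζ⁻¹-1‖⁻¹ · (2/ρ)`. [folklore] -/
theorem norm_charSum_le_first {m j : ℕ} (hm : 2 ≤ m) (hj : j < m) (hJ : 0 < min j (m - j))
    (hρ : 1 ≤ ρ) :
    ‖∑ t ∈ range m, ζ⟦m,j⟧ ^ t * (g (min (t % m) (m - t % m) : ℕ) : ℂ)‖ ≤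
      ‖(ζ⟦m,j⟧)⁻¹ - 1‖⁻¹ * (2 / ρ) := by
  have hm0 : m ≠ 0 := by omega
  have hζ1 : ζ⟦m,j⟧ ≠ 1 := by
    intro h
    have := inv_norm_zeta_sub_one_le hj hJ
    rw [h, sub_self, norm_zero, inv_zero] at this
    have hb : (0 : ℝ) < (min j (m - j) : ℕ) := by exact_mod_cast hJ
    have hmpos : (0 : ℝ) < m := by exact_mod_cast Nat.pos_of_ne_zero hm0
    have : (0 : ℝ) < (m : ℝ) / (4 * (min j (m - j) : ℕ)) := by positivity
    -- 0 ≤ m/(4J) is consistent; derive contradiction from ‖ζ - 1‖ = 0 < 4J/m bound instead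
    have h2 := two_mul_bar_div_le_abs_sin hj
    have hzero : ‖ζ⟦m,j⟧ - 1‖ = 0 := by rw [h, sub_self, norm_zero]
    rw [norm_zeta_sub_one] at hzero
    have : |Real.sin (Real.pi * j / m)| = 0 := by linarith
    rw [this] at h2
    have : 0 < 2 * ((min j (m - j) : ℕ) : ℝ) / m := by positivity
    linarith
  have hb := cyclic_abel1_bound (norm_zeta m j) hζ1 (zeta_pow_self m j hm0)
    (F := fun t => g (min (t % m) (m - t % m) : ℕ)) (by
      show g (min (m % m) (m - m % m) : ℕ) = g (min (0 % m) (m - 0 % m) : ℕ)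
      rw [Nat.mod_self, Nat.zero_mod])
  refine hb.trans ?_
  gcongr
  have htv := cyclicTV_le hm (g := g) (G_nonneg_nat hg) (G_antitoneOn_one hg)
  refine htv.trans ?_
  have hρ0 : 0 < ρ := by linarith
  have g0 : g 0 = ρ⁻¹ := by
    rw [hg]; congr 1
    rw [show (0:ℝ) ^ 2 + ρ ^ 2 = ρ ^ 2 by ring, Real.sqrt_sq hρ0.le]
  have g1 : g 1 ≤ g 0 :=
    G_antitoneOn hg hρ0.ne' Set.self_mem_Ici
      (show (1:ℝ) ∈ Set.Ici 0 by norm_num) (by norm_num)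
  have g1' : 0 ≤ g 1 := G_nonneg hg 1
  rw [abs_of_nonpos (by linarith), g0] at *
  have : 2 * (-(g 1 - ρ⁻¹) + g 1) = 2 / ρ := by ring
  rw [this]

/-- First-order bound, `ρ = 0`: `‖Σ_{t<m} ζ^t g(t̄)‖ ≤ ‖ζ⁻¹-1‖⁻¹ · 4` (here `g(0) = 0`, `g(n) = 1/n`).
[folklore] -/
theorem norm_charSum_le_first_zero {m j : ℕ} (hm : 2 ≤ m) (hj : j < m) (hJ : 0 < min j (m - j))
    (hρ : ρ = 0) :
    ‖∑ t ∈ range m, ζ⟦m,j⟧ ^ t * (g (min (t % m) (m - t % m) : ℕ) : ℂ)‖ ≤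
      ‖(ζ⟦m,j⟧)⁻¹ - 1‖⁻¹ * 4 := by
  have hm0 : m ≠ 0 := by omega
  have hζ1 : ζ⟦m,j⟧ ≠ 1 := by
    intro h
    have h2 := two_mul_bar_div_le_abs_sin hj
    have hzero : ‖ζ⟦m,j⟧ - 1‖ = 0 := by rw [h, sub_self, norm_zero]
    rw [norm_zeta_sub_one] at hzero
    have : |Real.sin (Real.pi * j / m)| = 0 := by linarith
    rw [this] at h2
    have hb : (0 : ℝ) < (min j (m - j) : ℕ) := by exact_mod_cast hJ
    have hmpos : (0 : ℝ) < m := by exact_mod_cast Nat.pos_of_ne_zero hm0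
    have : 0 < 2 * ((min j (m - j) : ℕ) : ℝ) / m := by positivity
    linarith
  have hb := cyclic_abel1_bound (norm_zeta m j) hζ1 (zeta_pow_self m j hm0)
    (F := fun t => g (min (t % m) (m - t % m) : ℕ)) (by
      show g (min (m % m) (m - m % m) : ℕ) = g (min (0 % m) (m - 0 % m) : ℕ)
      rw [Nat.mod_self, Nat.zero_mod])
  refine hb.trans ?_
  gcongr
  have htv := cyclicTV_le hm (g := g) (G_nonneg_nat hg) (G_antitoneOn_one hg)
  refine htv.trans ?_
  have g0 : g 0 = 0 := by rw [hg, hρ]; simp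
  have g1 : g 1 = 1 := by rw [hg, hρ]; simp
  rw [g0, g1]; norm_num

/-! ## Orders two and three -/

omit hg in
/-- The smooth second-difference stencil `A(u) = g(u+1) - 2g(u) + g(u-1)` evaluated at a folded coordinate:
one step of it costs at most `|A(v+1) - A v|` at `v = min((t+1)‾, (t+2)‾)`. [folklore] -/
theorem abs_stencil_step_le {m : ℕ} (hm : 2 ≤ m) (t : ℕ) :
    |(g ((min ((t + 2) % m) (m - (t + 2) % m) : ℕ) + 1) - 2 * g (min ((t + 2) % m) (m - (t + 2) % m) : ℕ)
        + g ((min ((t + 2) % m) (m - (t + 2) % m) : ℕ) - 1))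
      - (g ((min ((t + 1) % m) (m - (t + 1) % m) : ℕ) + 1) - 2 * g (min ((t + 1) % m) (m - (t + 1) % m) : ℕ)
        + g ((min ((t + 1) % m) (m - (t + 1) % m) : ℕ) - 1))| ≤
    |(g ((min (min ((t + 1) % m) (m - (t + 1) % m)) (min ((t + 2) % m) (m - (t + 2) % m)) : ℕ) + 1 + 1)
        - 2 * g ((min (min ((t + 1) % m) (m - (t + 1) % m)) (min ((t + 2) % m) (m - (t + 2) % m)) : ℕ) + 1)
        + g ((min (min ((t + 1) % m) (m - (t + 1) % m)) (min ((t + 2) % m) (m - (t + 2) % m)) : ℕ) + 1 - 1))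
      - (g ((min (min ((t + 1) % m) (m - (t + 1) % m)) (min ((t + 2) % m) (m - (t + 2) % m)) : ℕ) + 1)
        - 2 * g (min (min ((t + 1) % m) (m - (t + 1) % m)) (min ((t + 2) % m) (m - (t + 2) % m)) : ℕ)
        + g ((min (min ((t + 1) % m) (m - (t + 1) % m)) (min ((t + 2) % m) (m - (t + 2) % m)) : ℕ) - 1))| := by
  have h := abs_step_le hm (fun x => g (x + 1) - 2 * g x + g (x - 1)) (t + 1)
  simp only [show t + 1 + 1 = t + 2 by ring] at h
  exact h

/-- **Third-order bound.** For `ρ ≥ 1`, `m ≥ 3`, `j < m` with `j̄ ≥ 1`: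
`‖Σ_{t<m} ζ^t g_ρ(t̄)‖ ≤ ‖ζ⁻¹-1‖⁻³ · (288/ρ³) + ‖ζ⁻¹-1‖⁻² · 4(g(M₀-1) - g(M₀+1))`, `M₀ = m/2`. [folklore] -/
theorem norm_charSum_le_third {m j : ℕ} (hm : 3 ≤ m) (hj : j < m) (hJ : 0 < min j (m - j))
    (hρ : 1 ≤ ρ) :
    ‖∑ t ∈ range m, ζ⟦m,j⟧ ^ t * (g (min (t % m) (m - t % m) : ℕ) : ℂ)‖ ≤
      ‖(ζ⟦m,j⟧)⁻¹ - 1‖⁻¹ ^ 3 * (288 / ρ ^ 3) +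
        ‖(ζ⟦m,j⟧)⁻¹ - 1‖⁻¹ ^ 2 * (4 * (g ((m / 2 : ℕ) - 1) - g ((m / 2 : ℕ) + 1))) := by
  have hm0 : m ≠ 0 := by omega
  have hm2 : 2 ≤ m := by omega
  have hρ0 : 0 < ρ := by linarith
  have hρne : ρ ≠ 0 := hρ0.ne'
  have hζ1 : ζ⟦m,j⟧ ≠ 1 := by
    intro h
    have h2 := two_mul_bar_div_le_abs_sin hj
    have hzero : ‖ζ⟦m,j⟧ - 1‖ = 0 := by rw [h, sub_self, norm_zero]
    rw [norm_zeta_sub_one] at hzero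
    have : |Real.sin (Real.pi * j / m)| = 0 := by linarith
    rw [this] at h2
    have hb : (0 : ℝ) < (min j (m - j) : ℕ) := by exact_mod_cast hJ
    have hmpos : (0 : ℝ) < m := by exact_mod_cast Nat.pos_of_ne_zero hm0
    have : 0 < 2 * ((min j (m - j) : ℕ) : ℝ) / m := by positivity
    linarith
  -- notation: bars, the stencil A, the split a + b
  set F : ℕ → ℝ := fun t => g (min (t % m) (m - t % m) : ℕ) with hF
  set A : ℝ → ℝ := fun x => g (x + 1) - 2 * g x + g (x - 1) with hA
  set a : ℕ → ℝ := fun t => A (min ((t + 1) % m) (m - (t + 1) % m) : ℕ) with ha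
  set b : ℕ → ℝ := fun t => F (t + 2) - 2 * F (t + 1) + F t - a t with hb
  set M₀ : ℕ := m / 2 with hM₀
  set β : ℝ := g ((M₀ : ℝ) - 1) - g ((M₀ : ℝ) + 1) with hβ
  have hFper : ∀ t, F (t + m) = F t := by
    intro t; simp only [hF]; rw [bar_add_period]
  have haper : ∀ t, a (t + m) = a t := by
    intro t; simp only [ha]
    rw [show t + m + 1 = (t + 1) + m by ring, bar_add_period]
  have hab : ∀ t, F (t + 2) - 2 * F (t + 1) + F t = a t + b t := by
    intro t; simp only [hb]; ring
  have main := cyclic_abel23_bound (norm_zeta m j) hζ1 (zeta_pow_self m j hm0) hFper haper hab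
  -- (i) Σ |a(t+1) - a t| ≤ 2 · 144/ρ³
  have hM1 : 1 ≤ M₀ := by omega
  have hAsum : ∑ t ∈ range m, |a (t + 1) - a t| ≤ 2 * (144 / ρ ^ 3) := by
    set eA : ℕ → ℝ := fun v => |A ((v : ℝ) + 1) - A v| with heA
    have s1 : ∑ t ∈ range m, |a (t + 1) - a t|
        ≤ ∑ t ∈ range m, eA (min (min ((t + 1) % m) (m - (t + 1) % m))
            (min ((t + 2) % m) (m - (t + 2) % m))) := by
      refine sum_le_sum fun t _ => ?_
      have h := abs_stencil_step_le hm2 (g := g) t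
      simp only [ha, hA, heA, show t + 1 + 1 = t + 2 by ring]
      exact h.trans (le_of_eq rfl)
    have s2 : ∑ t ∈ range m, eA (min (min ((t + 1) % m) (m - (t + 1) % m))
        (min ((t + 2) % m) (m - (t + 2) % m))) ≤ 2 * ∑ v ∈ range (M₀ + 1), eA v := by
      refine sum_fiber_le_two_mul_sum (fun v => (abs_nonneg _ : 0 ≤ eA v)) (fun t _ => ?_)
        (card_filter_min_bar_succ_le_two hm2)
      exact (min_le_left _ _).trans (bar_le_half m (t + 1))
    have s3 : ∑ v ∈ range (M₀ + 1), eA v ≤ 144 / ρ ^ 3 := by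
      have h := sum_abs_third_diff_G_le hg hρ (σ := 1) (by norm_num) (M₀ + 1)
      refine le_trans (le_of_eq ?_) h
      refine sum_congr rfl fun v _ => ?_
      simp only [heA, hA, Nat.cast_one]
      congr 1
      ring_nf
    calc _ ≤ _ := s1
      _ ≤ 2 * ∑ v ∈ range (M₀ + 1), eA v := s2
      _ ≤ 2 * (144 / ρ ^ 3) := by gcongr
  -- (ii) Σ |b t| ≤ 4β
  have hganti := G_antitoneOn hg hρne
  have hβ0 : 0 ≤ β := by
    simp only [hβ]
    have := hganti (show (M₀ : ℝ) - 1 ∈ Set.Ici (0:ℝ) by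
        simp only [Set.mem_Ici]; have : (1:ℝ) ≤ M₀ := by exact_mod_cast hM1
        linarith)
      (show (M₀ : ℝ) + 1 ∈ Set.Ici (0:ℝ) by simp only [Set.mem_Ici]; positivity) (by linarith)
    linarith
  have hb_zero : ∀ t, t < m → min ((t + 1) % m) (m - (t + 1) % m) ≠ M₀ → b t = 0 := by
    intro t ht hc
    have hst := bar_stencil_of_ne_top hm ht hc
    simp only [hb, hF, ha, hA]
    set c : ℕ := min ((t + 1) % m) (m - (t + 1) % m) with hc_def
    rcases hst with ⟨h1, h2⟩ | ⟨h1, h2⟩ | ⟨h0, h1, h2⟩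
    · rw [h2]
      have : ((min (t % m) (m - t % m) : ℕ) : ℝ) = (c : ℝ) - 1 := by
        have : (c : ℝ) = (min (t % m) (m - t % m) : ℕ) + 1 := by exact_mod_cast h1.symm
        linarith
      rw [this]; push_cast; ring
    · rw [h1]
      have : ((min ((t + 2) % m) (m - (t + 2) % m) : ℕ) : ℝ) = (c : ℝ) - 1 := by
        have : (c : ℝ) = (min ((t + 2) % m) (m - (t + 2) % m) : ℕ) + 1 := by exact_mod_cast h2.symm
        linarith
      rw [this]; push_cast; ring
    · rw [h0, h1, h2]
      have hev : g ((0 : ℕ) - 1 : ℝ) = g 1 := by rw [hg, hg]; norm_num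
      rw [hev]; push_cast; ring
  have hb_top : ∀ t, t < m → min ((t + 1) % m) (m - (t + 1) % m) = M₀ → |b t| ≤ 2 * β := by
    intro t ht hc
    have hst := bar_stencil_of_eq_top hm ht hc
    -- values of g at levels M₀ - 1, M₀ are within [g M₀, g (M₀-1)]
    have hlev : ∀ u : ℕ, (u = M₀ - 1 ∨ u = M₀) →
        g (M₀ : ℝ) ≤ g (u : ℝ) ∧ g (u : ℝ) ≤ g ((M₀ : ℝ) - 1) := by
      intro u hu
      have hcast : ((M₀ - 1 : ℕ) : ℝ) = (M₀ : ℝ) - 1 := by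
        rw [Nat.cast_sub hM1]; simp
      rcases hu with rfl | rfl
      · rw [hcast]
        refine ⟨hganti ?_ ?_ (by linarith), le_rfl⟩
        · simp only [Set.mem_Ici]; have : (1:ℝ) ≤ M₀ := by exact_mod_cast hM1
          linarith
        · simp only [Set.mem_Ici]; positivity
      · refine ⟨le_rfl, hganti ?_ ?_ (by linarith)⟩
        · simp only [Set.mem_Ici]; have : (1:ℝ) ≤ M₀ := by exact_mod_cast hM1
          linarith
        · simp only [Set.mem_Ici]; positivity
    have hM0M1 : g ((M₀ : ℝ) + 1) ≤ g (M₀ : ℝ) :=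
      hganti (show (M₀ : ℝ) ∈ Set.Ici (0:ℝ) by simp only [Set.mem_Ici]; positivity)
        (show (M₀ : ℝ) + 1 ∈ Set.Ici (0:ℝ) by simp only [Set.mem_Ici]; positivity) (by linarith)
    obtain ⟨l0, u0⟩ := hlev _ hst.1
    obtain ⟨l2, u2⟩ := hlev _ hst.2
    simp only [hb, hF, ha, hA, hc]
    rw [abs_le]
    simp only [hβ]
    constructor <;> nlinarith
  have hBsum : ∑ t ∈ range m, |b t| ≤ 4 * β := by
    rw [← sum_filter_add_sum_filter_not (range m)
      (fun t => min ((t + 1) % m) (m - (t + 1) % m) = M₀)]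
    have hz : ∑ t ∈ (range m).filter (fun t => ¬ min ((t + 1) % m) (m - (t + 1) % m) = M₀), |b t| = 0 := by
      refine sum_eq_zero fun t ht => ?_
      simp only [mem_filter, mem_range] at ht
      rw [hb_zero t ht.1 ht.2, abs_zero]
    rw [hz, add_zero]
    calc ∑ t ∈ (range m).filter (fun t => min ((t + 1) % m) (m - (t + 1) % m) = M₀), |b t|
        ≤ ∑ t ∈ (range m).filter (fun t => min ((t + 1) % m) (m - (t + 1) % m) = M₀), 2 * β := by
          refine sum_le_sum fun t ht => ?_
          simp only [mem_filter, mem_range] at ht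
          exact hb_top t ht.1 ht.2
      _ = ((range m).filter (fun t => min ((t + 1) % m) (m - (t + 1) % m) = M₀)).card * (2 * β) := by
          rw [sum_const, nsmul_eq_mul]
      _ ≤ 2 * (2 * β) := by
          gcongr
          exact_mod_cast card_filter_bar_succ_eq_top_le_two hm2
      _ = 4 * β := by ring
  -- assemble
  refine main.trans ?_
  have hw0 : 0 ≤ ‖(ζ⟦m,j⟧)⁻¹ - 1‖⁻¹ := by positivity
  gcongr
  · exact hAsum.trans (le_of_eq (by ring))

omit hg in
/-- The kink size: `β = g(M₀-1) - g(M₀+1) ≤ 2M₀ · g(M₀-1)³` (`M₀ ≥ 1`, `ρ ≠ 0`). [folklore] -/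
theorem kink_le (hg : ∀ y, g y = (Real.sqrt (y ^ 2 + ρ ^ 2))⁻¹) (hρ : ρ ≠ 0) {M₀ : ℕ} (hM : 1 ≤ M₀) :
    g ((M₀ : ℝ) - 1) - g ((M₀ : ℝ) + 1) ≤ 2 * M₀ * g ((M₀ : ℝ) - 1) ^ 3 := by
  have h1 : (1 : ℝ) ≤ M₀ := by exact_mod_cast hM
  have h := G_sub_G_le hg hρ (x := (M₀ : ℝ) - 1) (y := (M₀ : ℝ) + 1) (by linarith) (by linarith)
  refine h.trans (le_of_eq ?_)
  ring

end charsum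

end Summit.AtomisticToContinuum.BoseEinsteinCondensation.Cruxes.LevyNegativeMoment.Birth.Riesz
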